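import Summits.ValiantsHypothesis.ValiantsHypothesis.Theorems.KPlusLogSqLawStaticPathOrder

/-!
# Route «KPlusLogSqLaw» — parametric max-weight independent set on a path: chains of unique optima have at most `C(n+1, 2)` steps

HONEST FRAMING.  Helper toward the crux `WeakLifting` (item `stmt-ValiantsHypothesis-19561`, route `KPlusLogSqLaw`, cell `pub-symmetroid`,
seat val-sym-lift-p4 g8, 2026-08-27) on the line of its witness-plan stub `stub_tridiagonalSectorB` (tropical twin of the STATIC tridiagonal
sector = parametric maximum-weight independent set on a path = Eppstein's parametric closure problem on the fence, arXiv:1504.04073).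
A hypothesis-light companion of val-sym-lift-p3 g6's `StaticPathFold.chain_le` (`≤ 66·n·(⌊log₂ n⌋+2)` under «no vanishing alternating
interval sum»): by the ORDER LEMMA (`eq_of_order`, `…StaticPathOrder`), two consecutive distinct unique optima are separated by a change of order
of some pair of the signed prefix-sum lines `S_0, …, S_n`; the sign of `S_p - S_q` is monotone in the parameter, so distinct steps are separated by
distinct pairs, and a chain of unique optima at parameters where the `S_x` take pairwise distinct values has at most `C(n+1, 2)` steps
(`chain_le_choose`) — better than the `n log n` law for `n ≤ 1300` or so, and with no non-degeneracy hypothesis on the weights.  Statements about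
a path DP; nothing here asserts anything about `WeakLifting`, `TropicalB`, `KPlusLogSqLaw`, the stub in its window, `MatrixDescartes`
(stmt-ValiantsHypothesis-18050) or `VP ≠ VNP`.
-/

set_option linter.dupNamespace false
set_option autoImplicit false

namespace Summit.ValiantsHypothesis.ValiantsHypothesis.Theorems.KPlusLogSqLaw

open Finset Classical

namespace StaticPathFold

noncomputable section

variable (w₁ w₀ : ℕ → ℝ)

/-- the sign of an affine function is monotone: a sign change on `[x₁, x₂]` fixes the sign at every `z ≥ x₂` to that at `x₂`
(nonzero values assumed). [folklore] -/
theorem affine_sign_persists {u v x₁ x₂ z : ℝ} (h12 : x₁ < x₂) (h2z : x₂ ≤ z) (hx₁ : u * x₁ + v ≠ 0) (hx₂ : u * x₂ + v ≠ 0)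
    (hflip : (u * x₁ + v < 0 ↔ ¬ u * x₂ + v < 0)) : (u * z + v < 0 ↔ u * x₂ + v < 0) := by
  by_cases h2 : u * x₂ + v < 0
  · -- decreasing: `u < 0`
    have h1 : 0 < u * x₁ + v := lt_of_le_of_ne (not_lt.mp (fun h => (hflip.mp h) h2)) (Ne.symm hx₁)
    have hu : u < 0 := by nlinarith
    constructor
    · intro _; exact h2
    · intro _; nlinarith
  · have h2' : 0 < u * x₂ + v := lt_of_le_of_ne (not_lt.mp h2) (Ne.symm hx₂)
    have h1 : u * x₁ + v < 0 := hflip.mpr h2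
    have hu : 0 < u := by nlinarith
    constructor
    · intro h; nlinarith
    · intro h; exact absurd h h2

/-- **CHAINS OF UNIQUE OPTIMA HAVE AT MOST `C(n+1, 2)` STEPS.**  For the block `i+1, …, i+n`: if `M_0, …, M_N` are unique maximisers at strictly
increasing parameters `θ_0 < ⋯ < θ_N` at which the signed prefix-sum lines `S_0, …, S_n` take pairwise distinct values, and consecutive maximisers
differ, then `N ≤ C(n+1, 2)`: each step is witnessed by a pair of prefix-sum lines changing order (order lemma), and a pair changes order only
once. [folklore] -/
theorem chain_le_choose (i n N : ℕ) (θs : Fin (N + 1) → ℝ) (hθ : StrictMono θs) (Ms : Fin (N + 1) → Finset ℕ)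
    (hmem : ∀ k, Ms k ∈ indepSets i n)
    (huniq : ∀ k, ∀ S ∈ indepSets i n, S ≠ Ms k → ∑ t ∈ S, W w₁ w₀ t (θs k) < ∑ t ∈ Ms k, W w₁ w₀ t (θs k))
    (hdis : ∀ k, ∀ p q, p ≤ n → q ≤ n → p ≠ q →
      L (altA (shift i w₁)) (altB (shift i w₀)) p (θs k) ≠ L (altA (shift i w₁)) (altB (shift i w₀)) q (θs k))
    (hch : ∀ e : Fin N, Ms e.castSucc ≠ Ms e.succ) : N ≤ (n + 1).choose 2 := by
  -- each step has a normalised witness pair `p < q ≤ n` whose order flips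
  have key : ∀ e : Fin N, ∃ pq : ℕ × ℕ, pq.1 < pq.2 ∧ pq.2 ≤ n ∧
      (L (altA (shift i w₁)) (altB (shift i w₀)) pq.1 (θs e.castSucc) < L (altA (shift i w₁)) (altB (shift i w₀)) pq.2 (θs e.castSucc) ↔
        ¬ L (altA (shift i w₁)) (altB (shift i w₀)) pq.1 (θs e.succ) < L (altA (shift i w₁)) (altB (shift i w₀)) pq.2 (θs e.succ)) := by
    intro e
    by_contra hnone
    apply hch e
    -- for a normalised pair the comparison transfers (else it would be a witness)
    have aux : ∀ p q, p < q → q ≤ n →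
        (L (altA (shift i w₁)) (altB (shift i w₀)) p (θs e.castSucc) < L (altA (shift i w₁)) (altB (shift i w₀)) q (θs e.castSucc) ↔
          L (altA (shift i w₁)) (altB (shift i w₀)) p (θs e.succ) < L (altA (shift i w₁)) (altB (shift i w₀)) q (θs e.succ)) := by
      intro p q hpq hq
      by_contra hc
      exact hnone ⟨(p, q), hpq, hq, (not_iff_comm.mp (_root_.not_iff.mp hc)).symm⟩
    refine eq_of_order w₁ w₀ (hmem _) (hmem _) (huniq _) (huniq _) fun p q hp hq => ?_
    rcases lt_trichotomy p q with hpq | rfl | hpq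
    · exact aux p q hpq hq
    · exact ⟨fun h => (lt_irrefl _ h).elim, fun h => (lt_irrefl _ h).elim⟩
    · -- orientation `q < p`: transfer the normalised pair and use distinctness at both parameters
      have h := aux q p hpq hp
      have d1 := hdis e.castSucc p q hp hq (Nat.ne_of_gt hpq)
      have d2 := hdis e.succ p q hp hq (Nat.ne_of_gt hpq)
      have e1 : L (altA (shift i w₁)) (altB (shift i w₀)) p (θs e.castSucc) < L (altA (shift i w₁)) (altB (shift i w₀)) q (θs e.castSucc) ↔
          ¬ L (altA (shift i w₁)) (altB (shift i w₀)) q (θs e.castSucc) < L (altA (shift i w₁)) (altB (shift i w₀)) p (θs e.castSucc) :=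
        ⟨fun h' h'' => lt_asymm h' h'', fun h' => lt_of_le_of_ne (not_lt.mp h') d1⟩
      have e2 : L (altA (shift i w₁)) (altB (shift i w₀)) p (θs e.succ) < L (altA (shift i w₁)) (altB (shift i w₀)) q (θs e.succ) ↔
          ¬ L (altA (shift i w₁)) (altB (shift i w₀)) q (θs e.succ) < L (altA (shift i w₁)) (altB (shift i w₀)) p (θs e.succ) :=
        ⟨fun h' h'' => lt_asymm h' h'', fun h' => lt_of_le_of_ne (not_lt.mp h') d2⟩
      rw [e1, e2, h]
  choose f hf using key
  -- the affine difference of two prefix-sum lines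
  have hD : ∀ (p q : ℕ) (τ : ℝ), L (altA (shift i w₁)) (altB (shift i w₀)) p τ - L (altA (shift i w₁)) (altB (shift i w₀)) q τ =
      (altA (shift i w₁) p - altA (shift i w₁) q) * τ + (altB (shift i w₀) p - altB (shift i w₀) q) := by
    intro p q τ; unfold L; ring
  -- `f` never repeats along increasing steps: the sign of `S_p - S_q` is monotone in the parameter
  have hmono : ∀ e e' : Fin N, e < e' → f e ≠ f e' := by
    intro e e' hlt heq
    obtain ⟨hpq, hqn, hflip⟩ := hf e
    obtain ⟨-, -, hflip'⟩ := hf e'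
    rw [← heq] at hflip'
    have hpn : (f e).1 ≤ n := by omega
    have hne : (f e).1 ≠ (f e).2 := Nat.ne_of_lt hpq
    -- the four sample points
    have h12 : θs e.castSucc < θs e.succ := hθ (Fin.castSucc_lt_succ)
    have h23 : θs e.succ ≤ θs e'.castSucc := hθ.monotone (Fin.le_iff_val_le_val.mpr (by
      rw [Fin.val_succ, Fin.val_castSucc]; exact hlt))
    have h34 : θs e'.castSucc < θs e'.succ := hθ (Fin.castSucc_lt_succ)
    -- rewrite all comparisons as signs of the affine difference
    set u := altA (shift i w₁) (f e).1 - altA (shift i w₁) (f e).2 with hu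
    set v := altB (shift i w₀) (f e).1 - altB (shift i w₀) (f e).2 with hv
    have hsgn : ∀ τ : ℝ, (L (altA (shift i w₁)) (altB (shift i w₀)) (f e).1 τ < L (altA (shift i w₁)) (altB (shift i w₀)) (f e).2 τ ↔
        u * τ + v < 0) := by
      intro τ; rw [← sub_neg, hD]
    have hnz : ∀ k : Fin (N + 1), u * θs k + v ≠ 0 := by
      intro k h0
      apply hdis k (f e).1 (f e).2 hpn hqn hne
      have := hD (f e).1 (f e).2 (θs k)
      rw [← hu, ← hv, h0] at this
      linarith
    rw [hsgn, hsgn] at hflip hflip'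
    have hp3 := affine_sign_persists h12 h23 (hnz _) (hnz _) hflip
    have hp4 := affine_sign_persists h12 (h23.trans h34.le) (hnz _) (hnz _) hflip
    rw [hp3, hp4] at hflip'
    exact (iff_not_self hflip').elim
  have hinj : Function.Injective f := by
    intro e e' hee'
    by_contra hne
    rcases lt_or_gt_of_ne hne with hlt | hlt
    · exact hmono e e' hlt hee'
    · exact hmono e' e hlt hee'.symm
  -- count: inject the steps into the 2-subsets of `{0, …, n}`
  set g : Fin N → Finset ℕ := fun e => {(f e).1, (f e).2} with hg
  have hgT : ∀ e ∈ (univ : Finset (Fin N)), g e ∈ (range (n + 1)).powersetCard 2 := by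
    intro e _
    obtain ⟨hpq, hqn, -⟩ := hf e
    rw [mem_powersetCard]
    refine ⟨fun x hx => ?_, ?_⟩
    · rw [hg, mem_insert, mem_singleton] at hx
      rw [mem_range]; omega
    · rw [hg, card_insert_of_notMem (by rw [mem_singleton]; omega), card_singleton]
  have hginj : Set.InjOn g ↑(univ : Finset (Fin N)) := by
    intro e _ e' _ hee'
    apply hinj
    obtain ⟨hpq, -, -⟩ := hf e
    obtain ⟨hpq', -, -⟩ := hf e'
    have h1 : (f e).1 ∈ g e' := by rw [← hee', hg]; simp
    have h2 : (f e).2 ∈ g e' := by rw [← hee', hg]; simp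
    have h3 : (f e').1 ∈ g e := by rw [hee', hg]; simp
    simp only [hg, mem_insert, mem_singleton] at h1 h2 h3
    exact Prod.ext (by omega) (by omega)
  have hcard := card_le_card_of_injOn g hgT hginj
  rwa [card_univ, Fintype.card_fin, card_powersetCard, card_range] at hcard

end

end StaticPathFold

end Summit.ValiantsHypothesis.ValiantsHypothesis.Theorems.KPlusLogSqLaw
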